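import Mathlib.Algebra.MvPolynomial.Monad
import Literature.Computability.Complexity.BallGates
import Literature.Computability.MetaComplexity.RazborovSmolenskyBall
import Literature.Computability.MetaComplexity.ProbabilisticDegreeThreshold
import HarnessLib

/-!
# The probabilistic degree of `G(k)` gates (Grewal–Kumar 2024, Lemma 3.6) — sharp form, modulo [STV]

Grewal–Kumar's Lemma 3.6 in its ADDITIVE form, as a theorem CONDITIONAL on the named fact
`STV2021_thresholdProbDegree` (Srinivasan–Tripathi–Venkitesh 2021, Thm. 18,
`ProbabilisticDegreeThreshold.lean`): every `G(k)` gate `g` (`Complexity/BallGates.lean`) has,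
for every `ε ∈ (0, 2^{-100})`, an `ε`-error probabilistic polynomial over `𝔽_p` of degree

  `≤ k + stvDegree p (k+1) ε = k + A_p√((k+1)·log₂(1/ε)) + B_p·log₂(1/ε)`  (`= O(k + log(1/ε))`),

`hasProbDegree_ballGate`. The construction is the printed one: `P_T = [b] + (1 - T(w))·(Q - [b])`
(`sharpBallPoly`) with `Q` the ball interpolant of `RazborovSmolenskyBall.lean` written as a
polynomial in the shifted literals `w_i = x_i ⊕ c_i` (`ballInterpPoly`, `eval_ballInterpPoly`,
degree `≤ k`), and `T` ranging over the support of the [STV] distribution for `Thr_m^{k+1}`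
composed with the shifted literals (`bind₁ litPoly`, which does not raise the total degree); the
gate distribution is the push-forward of the threshold distribution, and `P_T` errs at `x` only if
`T` errs at `x ⊕ c` (`eval_sharpBallPoly_eq`). Gates of fan-in `≤ k` are represented exactly
(`hasProbDegree_exact`). We omit the outer Fermat power `(·)^{p-1}` of the printed proof
(properness is not needed for `HasProbDegree`).

This is the per-gate input of the ADDITIVE-degree Razborov–Smolensky lemma for `GC⁰(k)[p]`
(Grewal–Kumar Thm. 3.8 as printed); the unconditional PRODUCT form is
`RazborovSmolenskyBallApprox.lean`. Deliberately NOT here: the circuit-level additive statement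
(needs the uniform-family form `HasUniformProbDegree` via `hasUniformProbDegree_of_hasProbDegree`
and a re-run of `RazborovSmolenskyBallApprox.lean` with `sharpBallPoly` read off the seed).

## References

* S. Grewal, V. M. Kumar, *Improved circuit lower bounds and quantum-classical separations*,
  arXiv:2408.16406 (2024), Lemma 3.4, Lemma 3.6 [GrewalKumar2024].
* S. Srinivasan, U. Tripathi, S. Venkitesh, *On the probabilistic degrees of symmetric Boolean
  functions*, SIDMA 2021, Thm. 18 [SrinivasanTripathiVenkitesh2021].
-/

noncomputable section

namespace Literature.Computability.MetaComplexity

open Finset Literature.Computability.Complexity MvPolynomial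

namespace Smolensky

open scoped Classical

/-! ### Monotonicity -/

/-- Probabilistic degree is monotone in the error and the degree bound.
[cite: SrinivasanTripathiVenkitesh2021, Definition 16] -/
theorem HasProbDegree.mono {F : Type*} [Field F] {n m : ℕ} {f : Fin m → (Fin n → Bool) → Bool}
    {ε ε' : ℝ} {d d' : ℕ} (h : HasProbDegree F f ε d) (hε : ε ≤ ε') (hd : d ≤ d') :
    HasProbDegree F f ε' d' := by
  obtain ⟨μ, hdeg, happ⟩ := h
  exact ⟨μ, fun P hP i => (hdeg P hP i).trans hd, fun x => (happ x).trans hε⟩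

variable {p : ℕ} [Fact p.Prime] {m : ℕ}

/-- `boolVal` over `𝔽_p` is the tree's `bit`. [folklore] -/
private theorem boolVal_eq_bit (b : Bool) : boolVal (ZMod p) b = bit p b := rfl

/-! ### The shifted literals and the ball interpolant as polynomials -/

/-- The shifted literal as a polynomial: `X_i` if `c_i = 0`, `1 - X_i` if `c_i = 1`. [folklore] -/
def litPoly (c : Fin m → Bool) (i : Fin m) : MvPolynomial (Fin m) (ZMod p) :=
  if c i then 1 - X i else X i

/-- Shifted literals have total degree `≤ 1`. [folklore] -/
private theorem totalDegree_litPoly_le (c : Fin m → Bool) (i : Fin m) :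
    (litPoly (p := p) c i).totalDegree ≤ 1 := by
  unfold litPoly
  split_ifs
  · refine (totalDegree_sub _ _).trans ?_
    rw [totalDegree_one, totalDegree_X]; simp
  · rw [totalDegree_X]

/-- Evaluating a shifted literal gives `lit`. [folklore] -/
private theorem eval_litPoly (c : Fin m → Bool) (i : Fin m) (v : Fin m → ZMod p) :
    eval v (litPoly c i) = lit (c i) (v i) := by
  unfold litPoly lit
  split_ifs <;> simp

/-- At a Boolean point the shifted literal is the bit of `x_i ⊕ c_i`. [folklore] -/
private theorem lit_bit_bne (b v : Bool) : lit b (bit p v) = bit p (v != b) := by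
  cases b <;> cases v <;> simp [lit, bit]

/-- The ball interpolant `Q` of `RazborovSmolenskyBall.lean` as a polynomial in the shifted
literals. [cite: GrewalKumar2024, Lemma 3.4] -/
def ballInterpPoly (k : ℕ) (op : (Fin m → Bool) → Bool) (c : Fin m → Bool) :
    MvPolynomial (Fin m) (ZMod p) :=
  ∑ S ∈ (univ : Finset (Fin m)).powerset.filter (fun S => S.card ≤ k),
    C (mobCoeff op c S) * ∏ i ∈ S, litPoly c i

/-- The ball interpolant has total degree `≤ k`. [cite: GrewalKumar2024, Lemma 3.4] -/
theorem totalDegree_ballInterpPoly_le (k : ℕ) (op : (Fin m → Bool) → Bool) (c : Fin m → Bool) :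
    (ballInterpPoly (p := p) k op c).totalDegree ≤ k := by
  unfold ballInterpPoly
  refine totalDegree_finsetSum_le fun S hS => ?_
  refine (totalDegree_mul _ _).trans ?_
  rw [totalDegree_C, zero_add]
  refine (totalDegree_finsetProd _ _).trans ?_
  refine ((Finset.sum_le_sum fun i _ => totalDegree_litPoly_le c i)).trans ?_
  simpa using (mem_filter.1 hS).2

/-- Evaluating the polynomial gives the function `ballInterp`. [cite: GrewalKumar2024, Lemma 3.4] -/
theorem eval_ballInterpPoly (k : ℕ) (op : (Fin m → Bool) → Bool) (c : Fin m → Bool)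
    (v : Fin m → ZMod p) : eval v (ballInterpPoly k op c) = ballInterp k op c v := by
  unfold ballInterpPoly ballInterp
  rw [map_sum]
  refine Finset.sum_congr rfl fun S _ => ?_
  rw [map_mul, eval_C, map_prod]
  simp_rw [eval_litPoly]

/-! ### Substituting degree-`≤ 1` polynomials does not raise the total degree -/

/-- If every `f i` has total degree `≤ 1`, then `bind₁ f P` has total degree `≤ deg P`.
[folklore] -/
private theorem totalDegree_bind₁_le_of_le_one {R : Type*} [CommRing R] {σ : Type*}
    (f : σ → MvPolynomial σ R) (hf : ∀ i, (f i).totalDegree ≤ 1) (P : MvPolynomial σ R) :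
    (bind₁ f P).totalDegree ≤ P.totalDegree := by
  conv_lhs => rw [P.as_sum]
  rw [map_sum]
  refine totalDegree_finsetSum_le fun s hs => ?_
  rw [bind₁_monomial]
  refine (totalDegree_mul _ _).trans ?_
  rw [totalDegree_C, zero_add]
  refine (totalDegree_finsetProd _ _).trans ?_
  refine le_trans (Finset.sum_le_sum fun i _ => (totalDegree_pow _ _).trans
    (Nat.mul_le_mul_left _ (hf i))) ?_
  simp_rw [mul_one]
  exact le_totalDegree hs

/-- Evaluation commutes with substitution. [folklore] -/
private theorem eval_bind₁ {R : Type*} [CommRing R] {σ : Type*} (f : σ → MvPolynomial σ R)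
    (g : σ → R) (P : MvPolynomial σ R) :
    eval g (bind₁ f P) = eval (fun i => eval g (f i)) P := by
  show eval₂Hom (RingHom.id R) g (bind₁ f P) = _
  rw [eval₂Hom_bind₁]
  rfl

/-! ### Grewal–Kumar's Lemma 3.6 with the STV threshold polynomial -/

/-- **The sharp ball-gate polynomial**: `P_T = [b] + (1 - T(w))·(Q - [b])` where `T ∈ 𝔽_p[X]` is a
(sample of a probabilistic) polynomial for `Thr_m^{k+1}` composed with the shifted literals
`w_i = x_i ⊕ c_i`, and `Q` the ball interpolant (Grewal–Kumar 2024, proof of Lemma 3.6, without the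
outer Fermat power). [cite: GrewalKumar2024, Lemma 3.6] -/
def sharpBallPoly (k : ℕ) (op : (Fin m → Bool) → Bool) (c : Fin m → Bool) (b : Bool)
    (T : MvPolynomial (Fin m) (ZMod p)) : MvPolynomial (Fin m) (ZMod p) :=
  C (bit p b) + (1 - bind₁ (litPoly c) T) * (ballInterpPoly k op c - C (bit p b))

/-- Degree of the sharp ball-gate polynomial: `≤ deg T + k`. [cite: GrewalKumar2024, Lemma 3.6] -/
theorem totalDegree_sharpBallPoly_le (k : ℕ) (op : (Fin m → Bool) → Bool) (c : Fin m → Bool)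
    (b : Bool) {T : MvPolynomial (Fin m) (ZMod p)} {D : ℕ} (hT : T.totalDegree ≤ D) :
    (sharpBallPoly k op c b T).totalDegree ≤ D + k := by
  unfold sharpBallPoly
  refine (totalDegree_add _ _).trans (max_le ?_ ?_)
  · rw [totalDegree_C]; exact Nat.zero_le _
  refine (totalDegree_mul _ _).trans (Nat.add_le_add ?_ ?_)
  · refine (totalDegree_sub _ _).trans (max_le ?_ ?_)
    · rw [totalDegree_one]; exact Nat.zero_le _
    · exact (totalDegree_bind₁_le_of_le_one _ (totalDegree_litPoly_le c) T).trans hT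
  · refine (totalDegree_sub _ _).trans (max_le (totalDegree_ballInterpPoly_le k op c) ?_)
    rw [totalDegree_C]; exact Nat.zero_le _

/-- The number of ones of `x ⊕ c` is the Hamming distance of `x` from `c`. [folklore] -/
private theorem numOnes_bne (x c : Fin m → Bool) :
    GateFn.numOnes (fun i => x i != c i) = (univ.filter fun i => x i ≠ c i).card := by
  unfold GateFn.numOnes
  congr 1
  ext i
  simp

/-- **Exactness off the threshold polynomial's errors**: if `op` is constantly `b` outside the
ball of radius `k` around `c` and `T` computes `Thr_m^{k+1}` correctly at `w = x ⊕ c`, then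
`P_T(x) = [op x]`. [cite: GrewalKumar2024, Lemma 3.6] -/
theorem eval_sharpBallPoly_eq (k : ℕ) (op : (Fin m → Bool) → Bool) (c : Fin m → Bool) (b : Bool)
    (hop : ∀ v : Fin m → Bool, k < (univ.filter fun i => v i ≠ c i).card → op v = b)
    (T : MvPolynomial (Fin m) (ZMod p)) (x : Fin m → Bool)
    (hT : eval (fun i => bit p (x i != c i)) T = bit p (thrFn m (k + 1) fun i => x i != c i)) :
    eval (fun i => bit p (x i)) (sharpBallPoly k op c b T) = bit p (op x) := by
  have hsub : eval (fun i => bit p (x i)) (bind₁ (litPoly c) T) =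
      bit p (thrFn m (k + 1) fun i => x i != c i) := by
    rw [eval_bind₁, ← hT]
    congr 2
    funext i
    rw [eval_litPoly, lit_bit_bne]
  unfold sharpBallPoly
  rw [map_add, map_mul, map_sub, map_sub, eval_C, map_one, hsub, eval_ballInterpPoly, thrFn,
    numOnes_bne]
  by_cases hk : k + 1 ≤ (univ.filter fun i => x i ≠ c i).card
  · -- outside the ball: `T = 1`, and the gate outputs `b`
    rw [decide_eq_true hk, bit_true, sub_self, zero_mul, add_zero, hop x hk]
  · -- inside the ball: `T = 0`, and `Q(x) = [op x]`
    rw [decide_eq_false hk, bit_false, sub_zero, one_mul,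
      ballInterp_bit_eq k op c x (by omega)]
    ring

/-- **Grewal–Kumar 2024, Lemma 3.6, explicit form, modulo [STV] Thm. 18**: every `G(k)` gate
`g` (any arity) has, for every `ε ∈ (0, 2^{-100})`, an `ε`-error probabilistic polynomial over
`𝔽_p` of degree at most `k + stvDegree p (k+1) ε = k + A_p√((k+1) log₂(1/ε)) + B_p log₂(1/ε)`
(`= O(k + log(1/ε))` as printed). Construction as printed: `[b] + (1 - T)(Q - [b])` with `Q` the
ball interpolant (Lemma 3.4) and `T` a sample of the STV polynomial for `Thr^{k+1}` in the shifted
literals; gates of fan-in `≤ k` are represented exactly. [cite: GrewalKumar2024, Lemma 3.6] -/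
theorem hasProbDegree_ballGate (hSTV : STV2021_thresholdProbDegree) {k : ℕ} {g : GateFn}
    (hg : g ∈ ballGates k) {ε : ℝ} (hε : 0 < ε) (hε' : ε < 1 / 2 ^ 100) :
    HasProbDegree (ZMod p) (fun _ : Fin 1 => g.2) ε (k + stvDegree p (k + 1) ε) := by
  obtain ⟨c, b, hop⟩ := hg
  by_cases hm : g.1 ≤ k
  · exact (hasProbDegree_exact (F := ZMod p) (fun _ : Fin 1 => g.2)).mono hε.le
      (hm.trans (Nat.le_add_right _ _))
  have hkm : k + 1 ≤ g.1 := by omega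
  have hn : 0 < g.1 := by omega
  obtain ⟨μ, hdeg, happ⟩ :=
    hSTV p g.1 (k + 1) 1 (fun _ => k + 1) hn hkm (fun _ => le_rfl) ε hε hε'
  -- push the threshold distribution forward under `T ↦ P_T`
  set Φ : (Fin 1 → MvPolynomial (Fin g.1) (ZMod p)) → (Fin 1 → MvPolynomial (Fin g.1) (ZMod p)) :=
    fun T _ => sharpBallPoly k g.2 c b (T 0) with hΦ
  let ν : ProbPolyTuple (ZMod p) g.1 1 :=
    { support := μ.support.image Φ
      weight := fun P => ∑ T ∈ μ.support.filter (fun T => Φ T = P), μ.weight T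
      weight_nonneg := fun P => Finset.sum_nonneg fun T _ => μ.weight_nonneg T
      sum_weight := by
        rw [Finset.sum_fiberwise_of_maps_to (fun T hT => Finset.mem_image_of_mem Φ hT),
          μ.sum_weight] }
  refine ⟨ν, ?_, ?_⟩
  · intro P hP i
    obtain ⟨T, hT, rfl⟩ := Finset.mem_image.1 hP
    have hi : i = 0 := Subsingleton.elim i 0
    subst hi
    show (sharpBallPoly k g.2 c b (T 0)).totalDegree ≤ k + stvDegree p (k + 1) ε
    rw [add_comm]
    exact totalDegree_sharpBallPoly_le k g.2 c b (hdeg T hT 0)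
  · intro x
    set w : Fin g.1 → Bool := fun i => x i != c i with hw
    -- a tuple that is correct for the threshold at `w` is correct for the gate at `x`
    have key : ∀ T, ProbPolyTuple.Errs (fun _ : Fin 1 => g.2) (Φ T) x →
        ProbPolyTuple.Errs (fun _ : Fin 1 => thrFn g.1 (k + 1)) T w := by
      intro T hE
      by_contra hT
      obtain ⟨i, hi⟩ := hE
      have hi0 : i = 0 := Subsingleton.elim i 0
      subst hi0
      apply hi
      simp only [ProbPolyTuple.Errs, not_exists, not_not] at hT
      have hT0 := hT 0
      show eval (fun j => boolVal (ZMod p) (x j)) (sharpBallPoly k g.2 c b (T 0)) =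
        boolVal (ZMod p) (g.2 x)
      simp only [boolVal_eq_bit] at hT0 ⊢
      exact eval_sharpBallPoly_eq k g.2 c b hop (T 0) x hT0
    have hfib : ν.errProb (fun _ : Fin 1 => g.2) x =
        ∑ T ∈ μ.support.filter (fun T => ProbPolyTuple.Errs (fun _ : Fin 1 => g.2) (Φ T) x),
          μ.weight T := by
      show ∑ P ∈ (μ.support.image Φ).filter (fun P => ProbPolyTuple.Errs (fun _ : Fin 1 => g.2) P x),
          ∑ T ∈ μ.support.filter (fun T => Φ T = P), μ.weight T = _
      rw [← Finset.sum_fiberwise_of_maps_to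
        (s := μ.support.filter fun T => ProbPolyTuple.Errs (fun _ : Fin 1 => g.2) (Φ T) x)
        (t := (μ.support.image Φ).filter fun P => ProbPolyTuple.Errs (fun _ : Fin 1 => g.2) P x)
        (g := Φ)
        (fun T hT => by
          simp only [Finset.mem_filter] at hT ⊢
          exact ⟨Finset.mem_image_of_mem Φ hT.1, hT.2⟩)]
      refine Finset.sum_congr rfl fun P hP => ?_
      refine Finset.sum_congr ?_ fun _ _ => rfl
      ext T
      simp only [Finset.mem_filter]
      constructor
      · rintro ⟨hT, hTP⟩
        exact ⟨⟨hT, by rw [hTP]; exact (Finset.mem_filter.1 hP).2⟩, hTP⟩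
      · rintro ⟨⟨hT, _⟩, h⟩; exact ⟨hT, h⟩
    rw [hfib]
    calc ∑ T ∈ μ.support.filter (fun T => ProbPolyTuple.Errs (fun _ : Fin 1 => g.2) (Φ T) x),
          μ.weight T
        ≤ ∑ T ∈ μ.support.filter
            (fun T => ProbPolyTuple.Errs (fun _ : Fin 1 => thrFn g.1 (k + 1)) T w), μ.weight T := by
          refine Finset.sum_le_sum_of_subset_of_nonneg ?_ fun T _ _ => μ.weight_nonneg T
          intro T hT
          simp only [Finset.mem_filter] at hT ⊢
          exact ⟨hT.1, key T hT.2⟩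
      _ ≤ ε := happ w


/-- **Grewal–Kumar 2024, Lemma 3.6 (additive form), UNCONDITIONAL**: a `G(k)` gate has an
`ε`-error probabilistic polynomial over `𝔽_p` of degree `≤ k + stvDegree p (k+1) ε`
(`= k + O_p(√((k+1) log(1/ε)) + log(1/ε)) = O_p(k + log(1/ε))`) for every `ε ∈ (0, 2^{-100})` — the
previous theorem fed with the discharged fact `STV2021_thresholdProbDegree_holds` (STV 2021 Thm. 18,
proved in `ProbabilisticDegreeThreshold.lean`). [cite: GrewalKumar2024, Lemma 3.6] -/
theorem hasProbDegree_ballGate_holds {k : ℕ} {g : GateFn} (hg : g ∈ ballGates k) {ε : ℝ}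
    (hε : 0 < ε) (hε' : ε < 1 / 2 ^ 100) :
    HasProbDegree (ZMod p) (fun _ : Fin 1 => g.2) ε (k + stvDegree p (k + 1) ε) :=
  hasProbDegree_ballGate STV2021_thresholdProbDegree_holds hg hε hε'

end Smolensky

end Literature.Computability.MetaComplexity
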